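import Mathlib
import Summits.Ventures.HodgeRepro.Tier4.Target
import Summits.Ventures.HodgeRepro.Tier4.Line3.KMDatum
import Summits.Ventures.HodgeRepro.Tier4.Line3.KMDatumS
import Summits.Ventures.HodgeRepro.Tier4.Line3.Defs
import Summits.Ventures.HodgeRepro.Tier4.Line3.HeckeEquivarianceLemmas

/-!
# Tier4/Line3/TorusInvariance — the quadruple summand `coefQ · kernel` is a function of the line tuple (L3.6a, R1)

Blind re-derivation cell `pub-hodge-repro`, Tier 4 «PROVE THE STEP» (README §9–§10), LINE L3, seat t4-L3-p1 (prover);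
support (S4c) of L3.6a `term_main_unfold` (lead S12253): the torus bookkeeping of the skeleton's step (R1) — «the torus
phases of `coefQ` and of `kernel` cancel by `weight` and `datum_smul`, which is what makes both well defined on lines».
In the FILED v0.14 shape (lead S12401) both weights are `0`: the coefficients are `E′^1`-INVARIANT (`ThetaData.weight`)
and so is the sesquilinear datum (`datumS_smul`), so every phase is `1`.

CONTENT.  For norm-one scalars `t_j` (`c(t_j) t_j = 1`) and `x' = (t_j • x_j)_j`:
* `heckeAct_smul`: `heckeAct h c (t • x) = heckeAct h c x` (invariance of `c`);
* `coefQ_smul`: `coefQ cf γ x' = coefQ cf γ x`;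
* `kernel_smul`: `kernel Φ x' z = kernel Φ x z` (`datumS_smul`, `ballCoord_smul`, `norm_τ₀_eq_one`);
* **`coefQ_mul_kernel_smul`**: `coefQ cf γ x' · kernel Φ x' z = coefQ cf γ x · kernel Φ x z`, and its form on
  representatives of one line tuple, `coefQ_mul_kernel_of_lines_eq`; hence `summand Φ cf γ w z = coefQ cf γ x · kernel Φ x z`
  for EVERY `x` with `lines x = w` (`summand_eq_of_lines_eq`).

Imports: t4-L3-p2's `Defs` (the objects) and `HeckeEquivarianceLemmas` (`ballCoord_smul`, `norm_τ₀_eq_one`,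
`lineStep_of_mk_eq`).  Nothing here asserts anything about the truth of (P); HC_CM is NOT proved by anyone in this
repository.
-/

set_option autoImplicit false

noncomputable section

namespace Summit.Ventures.HodgeRepro.Tier4.Line3

open Summit.Ventures.HodgeRepro.Tier4
open Matrix
open scoped ComplexConjugate
open HeckeEquivariance

namespace T4Data

variable (X : T4Data)

/-- `heckeAct` is invariant under the norm-one scalars when `c` is. -/
theorem heckeAct_smul (h : HeckeElement X.E) {c : (Fin 3 → X.E) → ℂ}
    (hw : ∀ t : X.E, X.c t * t = 1 → ∀ x, c (t • x) = c x) {t : X.E} (ht : X.c t * t = 1)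
    (x : Fin 3 → X.E) : X.heckeAct h c (t • x) = X.heckeAct h c x := by
  unfold T4Data.heckeAct
  congr 1
  refine List.map_congr_left fun tm _ => ?_
  congr 1
  refine Finset.sum_congr rfl fun r _ => ?_
  rw [Matrix.mulVec_smul, hw t ht]

/-- `coefQ` is invariant under the torus. -/
theorem coefQ_smul {K : X.Level} (cf : Fin 4 → (Fin 3 → X.E) → ℂ)
    (hw : ∀ j (t : X.E), X.c t * t = 1 → ∀ x, cf j (t • x) = cf j x) (γ : X.Tr K)
    (t : Fin 4 → X.E) (ht : ∀ j, X.c (t j) * t j = 1) (x : X.Tuple) :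
    X.coefQ cf γ (fun j => t j • x j) = X.coefQ cf γ x := by
  unfold T4Data.coefQ
  refine Finsupp.sum_congr fun h _ => ?_
  simp only [X.heckeAct_smul _ (hw _) (ht _)]

/-- The kernel is invariant under the torus (the sesquilinear datum has weight `0`). -/
theorem kernel_smul (Φ : KMDatumS) (t : Fin 4 → X.E) (ht : ∀ j, X.c (t j) * t j = 1) (x : X.Tuple)
    (z : Fin 2 → ℂ) : X.kernel Φ (fun j => t j • x j) z = X.kernel Φ x z := by
  unfold T4Data.kernel
  simp only [ballCoord_smul X]
  have hd : ∀ (j : Fin 4) (y : Fin 3 → ℂ),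
      (fun k => datumS Φ (X.τ₀ (t j) • y) z k) = fun k => datumS Φ y z k :=
    fun j y => funext fun k => datumS_smul Φ _ (norm_τ₀_eq_one X (ht j)) y z k
  change wedge (fun k => datumS Φ (X.τ₀ (t 0) • X.ballCoord (x 0)) z k)
      (fun k => datumS Φ (X.τ₀ (t 1) • X.ballCoord (x 1)) z k) *
    conj (wedge (fun k => datumS Φ (X.τ₀ (t 2) • X.ballCoord (x 2)) z k)
      (fun k => datumS Φ (X.τ₀ (t 3) • X.ballCoord (x 3)) z k)) = _
  rw [hd 0, hd 1, hd 2, hd 3]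

/-- **THE QUADRUPLE SUMMAND IS TORUS-INVARIANT**. -/
theorem coefQ_mul_kernel_smul {K : X.Level} (Φ : KMDatumS) (cf : Fin 4 → (Fin 3 → X.E) → ℂ)
    (hw : ∀ j (t : X.E), X.c t * t = 1 → ∀ x, cf j (t • x) = cf j x) (γ : X.Tr K)
    (t : Fin 4 → X.E) (ht : ∀ j, X.c (t j) * t j = 1) (x : X.Tuple) (z : Fin 2 → ℂ) :
    X.coefQ cf γ (fun j => t j • x j) * X.kernel Φ (fun j => t j • x j) z = X.coefQ cf γ x * X.kernel Φ x z := by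
  rw [X.coefQ_smul cf hw γ t ht x, X.kernel_smul Φ t ht x z]

/-- Two tuples with the same line tuple differ by norm-one scalars. -/
theorem exists_torus_of_lines_eq {x x' : X.Tuple} (h : X.lines x = X.lines x') :
    ∃ t : Fin 4 → X.E, (∀ j, X.c (t j) * t j = 1) ∧ ∀ j, x' j = t j • x j := by
  have hj : ∀ j, X.lineStep (x j) (x' j) := fun j =>
    lineStep_of_mk_eq X (congrFun h j)
  choose t ht using hj
  exact ⟨t, fun j => (ht j).1, fun j => (ht j).2⟩

/-- The quadruple summand depends only on the line tuple. -/
theorem coefQ_mul_kernel_of_lines_eq {K : X.Level} (Φ : KMDatumS) (cf : Fin 4 → (Fin 3 → X.E) → ℂ)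
    (hw : ∀ j (t : X.E), X.c t * t = 1 → ∀ x, cf j (t • x) = cf j x) (γ : X.Tr K)
    {x x' : X.Tuple} (h : X.lines x = X.lines x') (z : Fin 2 → ℂ) :
    X.coefQ cf γ x' * X.kernel Φ x' z = X.coefQ cf γ x * X.kernel Φ x z := by
  obtain ⟨t, ht, hx'⟩ := X.exists_torus_of_lines_eq h
  have : x' = fun j => t j • x j := funext hx'
  rw [this]
  exact X.coefQ_mul_kernel_smul Φ cf hw γ t ht x z

/-- The line tuple of the chosen representatives is the line tuple itself. -/
theorem lines_rep (w : X.LineTuple) : X.lines (X.rep w) = w := by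
  funext j
  exact Quot.out_eq (w j)

/-- **`summand` AT ANY REPRESENTATIVE**: `summand Φ cf γ w z = coefQ cf γ x · kernel Φ x z` whenever `lines x = w`. -/
theorem summand_eq_of_lines_eq {K : X.Level} (Φ : KMDatumS) (cf : Fin 4 → (Fin 3 → X.E) → ℂ)
    (hw : ∀ j (t : X.E), X.c t * t = 1 → ∀ x, cf j (t • x) = cf j x) (γ : X.Tr K)
    {w : X.LineTuple} {x : X.Tuple} (h : X.lines x = w) (z : Fin 2 → ℂ) :
    X.summand Φ cf γ w z = X.coefQ cf γ x * X.kernel Φ x z := by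
  unfold T4Data.summand
  exact X.coefQ_mul_kernel_of_lines_eq Φ cf hw γ (by rw [h, X.lines_rep]) z

end T4Data

end Summit.Ventures.HodgeRepro.Tier4.Line3

end
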